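import Mathlib
import HarnessLib
import Summits.CriticalPhenomena.CardyFormulaZ2.Theses.CardySelfDualSegment
import Literature.Probability.Percolation.CornerPercolation
import Literature.Barriers.CriticalPhenomena.EmbeddingModulusUniquenessProofs
import Literature.Probability.RandomPlanarGeometry.ConformalRectangleProofs
import Summits.CriticalPhenomena.CardyFormulaZ2.Theorems.CardySelfDualSegmentSegmentOpenStubCrossingProbPolynomial
import Summits.CriticalPhenomena.CardyFormulaZ2.Theorems.CardySelfDualSegmentSmirnovBasePoint

/-!
# Crux `SegmentOpen` (stmt-CriticalPhenomena-5471), line `Sketch`: stub JC `stub_jetConv`, order `k = 0`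

Worker file for the jet-convergence stub JC of the line.  JC asks, for every conformal rectangle
`R'` and every order `k`, that the `k`-th coefficient of the crossing polynomial `p_δ`
(`P_t(R', δ) = cornerCrossingProb t R' δ = p_δ(t)` on `[0, 1]`, S1 `stub_crossingProbPolynomial`)
converge as the mesh `δ → 0⁺`.  For `k ≥ 1` this contains first-order marginality at the Smirnov
point (`RussoBoundAt` at `t₀ = 0`, an open problem) and is NOT attempted here.

The order `k = 0` is Smirnov's theorem and is proved here as the registered helper
`jetConv_zero`: `coeff_0 p_δ = p_δ(0) = P_0(R', δ)` (`Polynomial.coeff_zero_eq_eval_zero`, the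
specification at `t = 0 ∈ [0, 1]`), and `P_0(R', δ) → F(crossRatio x)` as `δ → 0⁺` for any
`ζ`-sheared uniformized presentation `(R, φ, x)` of `R'` (`smirnovBasePoint_proof`, crux
`SmirnovBasePoint`, landed), which exists by the Riemann–Carathéodory uniformization of the sheared
marked domain `φ_ζ R'` (`MarkedDomain.exists_isUniformizing_holds`).  The `ε`–`δ₀` form is read off
the filter `𝓝[>] 0` (`mem_nhdsGT_iff_exists_Ioo_subset`).
-/

noncomputable section

namespace Summit.CriticalPhenomena.CardyFormulaZ2.Theorems

open Literature.Probability Literature.Barriers.CriticalPhenomena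
open Literature.Probability.RandomPlanarGeometry (ConformalRectangle ConformalEquiv MarkedDomain)
open Filter Set Topology MeasureTheory
open UpperHalfPlane (upperHalfPlaneSet)

namespace JetConv

/-- **Sheared presentations exist.** For every conformal rectangle `R'` and every `β ∉ ℝ` the
sheared marked domain `φ_β R'` (`R'.map (shearHomeomorph β)`: carrier `φ_β '' R'.carrier`, marked
points `φ_β (R'.pt i)`) admits a uniformizing datum `(φ, x)` (Riemann mapping + Carathéodory,
`MarkedDomain.exists_isUniformizing_holds`). [folklore] -/
theorem exists_shear_presentation (R' : ConformalRectangle) {β : ℂ} (hβ : β.im ≠ 0) :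
    ∃ (R : ConformalRectangle) (φ : ConformalEquiv UpperHalfPlane.upperHalfPlaneSet R.carrier)
      (x : Fin 4 → ℝ),
      R.carrier = moduliShear β '' R'.carrier ∧ (∀ i, R.pt i = moduliShear β (R'.pt i)) ∧
        R.IsUniformizing φ x := by
  obtain ⟨φ, x, hφ⟩ :=
    Literature.Probability.RandomPlanarGeometry.MarkedDomain.exists_isUniformizing_holds
      (R'.map (shearHomeomorph β hβ))
  exact ⟨_, φ, x, by rw [MarkedDomain.carrier_map, coe_shearHomeomorph],
    fun i => by rw [MarkedDomain.pt_map, coe_shearHomeomorph], hφ⟩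

/-- **Smirnov's theorem for the crude `M_0` event, existence form.** For every conformal rectangle
`R'` the crude `M_0` crossing probabilities `P_0(R', δ)` converge as `δ → 0⁺` (to the Cardy value
of a `ζ`-sheared presentation of `R'`, crux `SmirnovBasePoint` = `smirnovBasePoint_proof`).
[folklore] -/
theorem exists_tendsto_cornerCrossingProb_zero (R' : ConformalRectangle) :
    ∃ L : ℝ, Tendsto (Percolation.cornerCrossingProb 0 R') (𝓝[>] 0) (𝓝 L) := by
  obtain ⟨R, φ, x, hcar, hpt, hφ⟩ :=
    exists_shear_presentation R' Literature.Probability.Percolation.triZeta_im_ne_zero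
  have h : Summit.CriticalPhenomena.CardyFormulaZ2.Theses.CardySelfDualSegment.SmirnovBasePoint :=
    smirnovBasePoint_proof
  exact ⟨_, h R R' φ x hcar hpt hφ⟩

/-- **The constant coefficient of a crossing polynomial is `P_0`.** If `p` computes the crude
crossing probabilities of `R'` at mesh `δ` on `[0, 1]`, then `coeff_0 p = p(0) = P_0(R', δ)`.
[folklore] -/
theorem coeff_zero_eq (R' : ConformalRectangle) (δ : ℝ) (p : Polynomial ℝ)
    (hp : ∀ t : unitInterval, Percolation.cornerCrossingProb t R' δ = p.eval (t : ℝ)) :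
    p.coeff 0 = Percolation.cornerCrossingProb 0 R' δ := by
  rw [Polynomial.coeff_zero_eq_eval_zero, hp 0, Set.Icc.coe_zero]

/-- **`ε`–`δ₀` form of a one-sided limit at `0`.** [folklore] -/
theorem exists_forall_abs_sub_lt_of_tendsto {f : ℝ → ℝ} {L : ℝ}
    (hf : Tendsto f (𝓝[>] 0) (𝓝 L)) {ε : ℝ} (hε : 0 < ε) :
    ∃ δ₀ > 0, ∀ δ : ℝ, 0 < δ → δ < δ₀ → |f δ - L| < ε := by
  have h1 : {δ : ℝ | dist (f δ) L < ε} ∈ 𝓝[>] (0 : ℝ) := Metric.tendsto_nhds.1 hf ε hε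
  obtain ⟨u, hu, hsub⟩ := mem_nhdsGT_iff_exists_Ioo_subset.1 h1
  refine ⟨u, hu, fun δ hδ hδu => ?_⟩
  have h2 : dist (f δ) L < ε := hsub ⟨hδ, hδu⟩
  rwa [Real.dist_eq] at h2

end JetConv

open JetConv in
/-- **JC at order `k = 0` (Smirnov's theorem).** For every conformal rectangle `R'` there is a
number `a` (the Cardy value `F(crossRatio x)` of any `ζ`-sheared uniformized presentation of `R'`)
such that the constant coefficients of the crossing polynomials `p_δ` of `R'`
(`P_t(R', δ) = p_δ(t)` on `[0, 1]`) are within `ε` of `a` for all small meshes `δ`: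
`coeff_0 p_δ = P_0(R', δ) → a` (`smirnovBasePoint_proof`).
[cite: Smirnov2001, Thm. 1] -/
theorem jetConv_zero :
    ∀ (R' : ConformalRectangle), ∃ a : ℝ, ∀ ε > 0, ∃ δ₀ > 0, ∀ δ : ℝ, 0 < δ → δ < δ₀ →
      ∀ p : Polynomial ℝ,
        (∀ t : unitInterval, Percolation.cornerCrossingProb t R' δ = p.eval (t : ℝ)) →
        |p.coeff 0 - a| < ε := by
  intro R'
  obtain ⟨L, hL⟩ := exists_tendsto_cornerCrossingProb_zero R'
  refine ⟨L, fun ε hε => ?_⟩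
  obtain ⟨δ₀, hδ₀, h⟩ := exists_forall_abs_sub_lt_of_tendsto hL hε
  refine ⟨δ₀, hδ₀, fun δ hδ hδδ₀ p hp => ?_⟩
  rw [coeff_zero_eq R' δ p hp]
  exact h δ hδ hδδ₀

end Summit.CriticalPhenomena.CardyFormulaZ2.Theorems
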